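import Mathlib

/-!
# `SnSubsetDichotomy.ThresholdSubsetTriples` — stub `stub_cayleyDeletion` by explicit greedy deletion

Crux `stmt-MatrixMultiplication-10882` (`ThresholdSubsetTriples`), registered stub `stub_cayleyDeletion`
(Cayley-graph deletion, line `SketchIdeator2`); siege seat k10, variation "explicit / elementary route".

**Statement.**  For finite `K, B ⊆ S_n` there is `X ⊆ K` avoiding `B` as a right quotient
(`x * x'⁻¹ ∈ B → x = x'` for `x, x' ∈ X`) with `|K| ≤ (2|B| + 1)·|X|`.

**Proof (the greedy deletion algorithm, run as a strong induction).**  The group structure is used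
only to bound a degree, so the induction is done once and for all for an arbitrary "bad" relation `r`
on a finite set `K` in which every point `y` has at most `d` bad neighbours
(`z ≠ y` with `r z y ∨ r y z`): there is `X ⊆ K` with no bad pair of distinct members and
`|K| ≤ (d + 1)|X|` (`exists_subset_card_le_of_degree_le`).  If `K = ∅` take `X = ∅`.  Otherwise pick
`y ∈ K`, delete `y` and its bad neighbours, i.e. keep the survivors
`K' := {z ∈ K | z ≠ y ∧ ¬ r z y ∧ ¬ r y z} ⊊ K` (degrees only drop), recurse to get `X' ⊆ K'`, and put
`y` back: `insert y X'` has no bad pair, since a bad pair through `y` would involve a survivor, which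
the filter excludes in both orders (`insert_admissible`); and one step deletes at most `d + 1` points
(`subset_survivors_union`, `card_le_card_survivors_add`), so
`|K| ≤ |K'| + (d + 1) ≤ (d + 1)(|X'| + 1) = (d + 1)|insert y X'|`.
For the stub take `r x x' :↔ x * x'⁻¹ ∈ B` on `S_n`: the bad neighbours of `y` inside `K` lie in
`B · y ∪ B⁻¹ · y` (`z * y⁻¹ = b` gives `z = b * y`, `y * z⁻¹ = b` gives `z = b⁻¹ * y`), so `d = 2|B|`
works (`card_badNeighbours_le`).

No maximal / extremal object is chosen and no covering of `K` by balls around a finished `X` is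
counted (contrast the tree's `CayleyDeletion.exists_subset_avoiding_quotients`, p85947: admissible
subset of maximum cardinality + domination); the induction literally follows the run of the algorithm
"choose a point, delete it with its bad neighbours, repeat on the survivors", and the combinatorial
core is stated for any relation (greedy independent set: `|V| ≤ (Δ + 1)·α` for a graph of maximum
degree `Δ`), which the tree did not have in this `Finset` form.
-/

namespace Summit.MatrixMultiplication.MatrixMultiplication.Theorems.ThresholdSubsetTriples

namespace CayleyDeletionElementary

section Greedy

variable {α : Type*} [DecidableEq α] (r : α → α → Prop) [DecidableRel r]

/-- One greedy step loses only the chosen point and its bad neighbours: every point of `K` is a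
survivor (`z ≠ y ∧ ¬ r z y ∧ ¬ r y z`) or is `y` or a bad neighbour of `y` inside `K`. [folklore] -/
theorem subset_survivors_union (K : Finset α) (y : α) :
    K ⊆ K.filter (fun z => z ≠ y ∧ ¬ r z y ∧ ¬ r y z) ∪
      insert y (K.filter (fun z => z ≠ y ∧ (r z y ∨ r y z))) := by
  intro z hz
  rw [Finset.mem_union, Finset.mem_insert, Finset.mem_filter, Finset.mem_filter]
  by_cases hzy : z = y
  · exact Or.inr (Or.inl hzy)
  · by_cases h : r z y ∨ r y z
    · exact Or.inr (Or.inr ⟨hz, hzy, h⟩)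
    · exact Or.inl ⟨hz, hzy, fun h' => h (Or.inl h'), fun h' => h (Or.inr h')⟩

/-- The count for one greedy step: `|K| ≤ |survivors| + (|bad neighbours of y| + 1)`. [folklore] -/
theorem card_le_card_survivors_add (K : Finset α) (y : α) :
    K.card ≤ (K.filter (fun z => z ≠ y ∧ ¬ r z y ∧ ¬ r y z)).card +
      ((K.filter (fun z => z ≠ y ∧ (r z y ∨ r y z))).card + 1) :=
  calc K.card ≤ (K.filter (fun z => z ≠ y ∧ ¬ r z y ∧ ¬ r y z) ∪
          insert y (K.filter (fun z => z ≠ y ∧ (r z y ∨ r y z)))).card :=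
        Finset.card_le_card (subset_survivors_union r K y)
    _ ≤ (K.filter (fun z => z ≠ y ∧ ¬ r z y ∧ ¬ r y z)).card +
          (insert y (K.filter (fun z => z ≠ y ∧ (r z y ∨ r y z)))).card :=
        Finset.card_union_le _ _
    _ ≤ (K.filter (fun z => z ≠ y ∧ ¬ r z y ∧ ¬ r y z)).card +
          ((K.filter (fun z => z ≠ y ∧ (r z y ∨ r y z))).card + 1) :=
        Nat.add_le_add_left (Finset.card_insert_le _ _) _

/-- Putting the chosen point back: if `X'` is a set of survivors of the step at `y` with no bad pair
of distinct members, then neither has `insert y X'` — a bad pair through `y` would be `r y z` or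
`r z y` for a survivor `z`, excluded by the survivor filter. [folklore] -/
theorem insert_admissible (K X' : Finset α) (y : α)
    (hX' : X' ⊆ K.filter (fun z => z ≠ y ∧ ¬ r z y ∧ ¬ r y z))
    (hadm : ∀ x ∈ X', ∀ x' ∈ X', r x x' → x = x') :
    ∀ x ∈ insert y X', ∀ x' ∈ insert y X', r x x' → x = x' := by
  intro x hx x' hx' hB
  rcases Finset.mem_insert.1 hx with rfl | hxX'
  · rcases Finset.mem_insert.1 hx' with rfl | hx'X'
    · rfl
    · exact absurd hB (Finset.mem_filter.1 (hX' hx'X')).2.2.2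
  · rcases Finset.mem_insert.1 hx' with rfl | hx'X'
    · exact absurd hB (Finset.mem_filter.1 (hX' hxX')).2.2.1
    · exact hadm x hxX' x' hx'X' hB

/-- **Greedy independent set, explicit form.**  If every point `y` of the finite set `K` has at most
`d` bad neighbours inside `K` (points `z ≠ y` with `r z y ∨ r y z`), then some `X ⊆ K` has no bad pair
of distinct members and `K.card ≤ (d + 1) * X.card`.  Strong induction on `K` along the greedy run:
choose `y ∈ K`, recurse on the survivors `{z ∈ K | z ≠ y ∧ ¬ r z y ∧ ¬ r y z} ⊊ K` (whose degrees are
still `≤ d`), put `y` back (`insert_admissible`) and add the one-step count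
(`card_le_card_survivors_add`). [folklore] -/
theorem exists_subset_card_le_of_degree_le (d : ℕ) (K : Finset α)
    (hdeg : ∀ y ∈ K, (K.filter (fun z => z ≠ y ∧ (r z y ∨ r y z))).card ≤ d) :
    ∃ X ⊆ K, (∀ x ∈ X, ∀ x' ∈ X, r x x' → x = x') ∧ K.card ≤ (d + 1) * X.card := by
  induction K using Finset.strongInduction with
  | H K ih =>
    rcases K.eq_empty_or_nonempty with rfl | ⟨y, hy⟩
    · exact ⟨∅, Finset.empty_subset _, by simp, by simp⟩
    · -- recurse on the survivors of the greedy step at `y` (a proper subset: `y` itself is deleted)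
      have hK'K : K.filter (fun z => z ≠ y ∧ ¬ r z y ∧ ¬ r y z) ⊂ K :=
        Finset.filter_ssubset.2 ⟨y, hy, fun h => h.1 rfl⟩
      obtain ⟨X', hX'K', hX'adm, hX'card⟩ := ih _ hK'K (fun y' hy' =>
        (Finset.card_le_card (Finset.filter_subset_filter _ (Finset.filter_subset _ K))).trans
          (hdeg y' (Finset.filter_subset _ K hy')))
      have hyX' : y ∉ X' := fun h => (Finset.mem_filter.1 (hX'K' h)).2.1 rfl
      refine ⟨insert y X', Finset.insert_subset hy (hX'K'.trans (Finset.filter_subset _ _)),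
        insert_admissible r K X' y hX'K' hX'adm, ?_⟩
      rw [Finset.card_insert_of_notMem hyX']
      calc K.card ≤ (K.filter (fun z => z ≠ y ∧ ¬ r z y ∧ ¬ r y z)).card +
              ((K.filter (fun z => z ≠ y ∧ (r z y ∨ r y z))).card + 1) :=
            card_le_card_survivors_add r K y
        _ ≤ (d + 1) * X'.card + (d + 1) :=
            Nat.add_le_add hX'card (Nat.add_le_add_right (hdeg y hy) 1)
        _ = (d + 1) * (X'.card + 1) := by ring

end Greedy

section Group

variable {G : Type*} [Group G] [DecidableEq G]

/-- The degree bound in a group: for the bad relation `x * x'⁻¹ ∈ B`, the bad neighbours of `y`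
inside `K` lie in `B · y ∪ B⁻¹ · y` (`z * y⁻¹ = b ∈ B` gives `z = b * y`; `y * z⁻¹ = b ∈ B` gives
`z = b⁻¹ * y`), hence there are at most `2|B|` of them. [folklore] -/
theorem card_badNeighbours_le (K B : Finset G) (y : G) :
    (K.filter (fun z => z ≠ y ∧ (z * y⁻¹ ∈ B ∨ y * z⁻¹ ∈ B))).card ≤ 2 * B.card := by
  have hsub : K.filter (fun z => z ≠ y ∧ (z * y⁻¹ ∈ B ∨ y * z⁻¹ ∈ B)) ⊆
      B.image (fun b => b * y) ∪ B.image (fun b => b⁻¹ * y) := by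
    intro z hz
    rw [Finset.mem_union, Finset.mem_image, Finset.mem_image]
    rcases (Finset.mem_filter.1 hz).2.2 with hzB | hyz
    · exact Or.inl ⟨z * y⁻¹, hzB, inv_mul_cancel_right z y⟩
    · exact Or.inr ⟨y * z⁻¹, hyz, by group⟩
  calc (K.filter (fun z => z ≠ y ∧ (z * y⁻¹ ∈ B ∨ y * z⁻¹ ∈ B))).card
      ≤ (B.image (fun b => b * y) ∪ B.image (fun b => b⁻¹ * y)).card := Finset.card_le_card hsub
    _ ≤ (B.image (fun b => b * y)).card + (B.image (fun b => b⁻¹ * y)).card :=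
        Finset.card_union_le _ _
    _ ≤ B.card + B.card := Nat.add_le_add Finset.card_image_le Finset.card_image_le
    _ = 2 * B.card := by ring

end Group

/-- **Stub `stub_cayleyDeletion` — Cayley-graph deletion** (crux `SnSubsetDichotomy.ThresholdSubsetTriples`,
stmt-MatrixMultiplication-10882; registered signature verbatim; siege seat k10, explicit greedy-deletion
proof).  For finite `K, B ⊆ S_n` there is `X ⊆ K` avoiding `B` as a right quotient
(`x x'⁻¹ ∈ B ⇒ x = x'`) with `|K| ≤ (2|B| + 1)|X|`: the greedy lemma
`exists_subset_card_le_of_degree_le` for the relation `x * x'⁻¹ ∈ B` with `d = 2|B|`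
(`card_badNeighbours_le`). [folklore] -/
theorem stub_cayleyDeletion : ∀ (n : ℕ) (K B : Finset (Equiv.Perm (Fin n))), ∃ X ⊆ K, (∀ x ∈ X, ∀ x' ∈ X, x * x'⁻¹ ∈ B → x = x') ∧ K.card ≤ (2 * B.card + 1) * X.card :=
  fun _ K B => exists_subset_card_le_of_degree_le (fun x x' => x * x'⁻¹ ∈ B) (2 * B.card) K
    (fun y _ => card_badNeighbours_le K B y)

end CayleyDeletionElementary

end Summit.MatrixMultiplication.MatrixMultiplication.Theorems.ThresholdSubsetTriples
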